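import Summits.ValiantsHypothesis.ValiantsHypothesis.Theorems.KPlusLogSqLawWeakLiftingTowerGraftTowerTwoSidedWitnessFourteen

/-!
# `WeakLifting`, line (B) `tower_graft` — the `m = 4` tower witness is DEPTH-TYPE: a two-dimensional negative subspace inside an excursion

Crux `stmt-ValiantsHypothesis-19561` (`Theses.KPlusLogSqLaw.WeakLifting`), companion of `…TowerGraftTowerTwoSidedWitnessFourteen` (`T₁₄`: `Z₊ ≥ 14
= 4m − 2` on the 4-tower `(0,1,5,25)`, p685203).  The cell's instrument columns I1–I3 (crit-6 READ #103 / ACK #25, idea-24 memo §10.6) read the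
`m ≤ 3` extremal witnesses as EXCURSION-TYPE — along the positive axis at most ONE eigenvalue of the pencil is ever negative, so
`Z = 2E` with `E` the number of negative excursions of `λ_min` — and located the `m = 4` record as DEPTH-TYPE instead: exact inertia
sequence `0,1,2,1,2,1,2,1,0,1,0,1,0,1,0` at the certificate's test points, i.e. `(Z, E, max n₋) = (14, 4, 2)`.  This file puts the
depth into the kernel for the typed witness `T₁₄`: at `t = 1/2` (between its second and third certified roots) the real symmetric matrix
`M(1/2) = (1/2)^1 • J + ∑ₖ (1/2)^{dₖ} • Pₖ` is NEGATIVE DEFINITE ON A TWO-DIMENSIONAL SUBSPACE: for the integer vectors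
`v = (29, −10, 10, 80)`, `w = (−80, 38, −23, 36)` one has `vᵀMv < 0`, `wᵀMw < 0` and `(vᵀMv)(wᵀMw) − (vᵀMw)² > 0` (the Gram matrix of the
form on `span{v, w}` is negative definite), so `M(1/2)` has at least two negative eigenvalues (Cauchy interlacing) although
`det M(1/2) > 0` (`alt₁₄`: the sign at `1/2` is `+`); the mirror certificate `pos_two_T₁₄_half` (positive definite on another 2-plane) pins the
inertia of `M(1/2)` to exactly `(2+, 2−)`.  So the `4m − 2` at `m = 4` is NOT realised by `2m − 1` simple excursions of one
eigenvalue.  A `norm_num` certificate; nothing here bears on the registered stubs S4…S5ᴸ / `TowerB`, on `WeakLifting`, or on `VP ≠ VNP`.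

[folklore] Sylvester's law of inertia / Cauchy interlacing for the reading; the typed statement is the raw certificate.
-/

-- `Summit.ValiantsHypothesis.ValiantsHypothesis.…` repeats a component by the D-0017 layout
-- (single-conjunct summit), which the `dupNamespace` linter flags; the name is mandated.
set_option linter.dupNamespace false

namespace Summit.ValiantsHypothesis.ValiantsHypothesis.Theorems.KPlusLogSqLaw.TowerGraft

open scoped BigOperators Matrix
open TowerTwoSidedWitnessFourteen

/-- **DEPTH CERTIFICATE for `T₁₄` at `t = 1/2`**: the quadratic form of `M(1/2) = (1/2)^e • J + ∑ₖ (1/2)^{dₖ} • Pₖ` is negative definite on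
`span{(29,−10,10,80), (−80,38,−23,36)}` — two negative eigenvalues inside the second excursion. -/
theorem depth_two_T₁₄_half :
    let M : Matrix (Fin 4) (Fin 4) ℝ := ((1 / 2 : ℝ) ^ e₁₄) • J₁₄ + ∑ k, ((1 / 2 : ℝ) ^ d₁₄ k) • P₁₄ k
    let v : Fin 4 → ℝ := ![29, -10, 10, 80]
    let w : Fin 4 → ℝ := ![-80, 38, -23, 36]
    v ⬝ᵥ (M *ᵥ v) < 0 ∧ w ⬝ᵥ (M *ᵥ w) < 0 ∧ 0 < (v ⬝ᵥ (M *ᵥ v)) * (w ⬝ᵥ (M *ᵥ w)) - (v ⬝ᵥ (M *ᵥ w)) ^ 2 := by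
  simp only [P₁₄_eq, J₁₄, d₁₄, e₁₄, Fin.sum_univ_three]
  refine ⟨?_, ?_, ?_⟩ <;>
    simp [Matrix.mulVec, dotProduct, Fin.sum_univ_four, Matrix.add_apply] <;> norm_num

/-- Mirror certificate (crit-6 READ #122 (d1)): the same form is POSITIVE definite on `span{(1,1,1,1), (1,1,0,1)}`, so `M(1/2)` also has at least two
positive eigenvalues — together with `depth_two_T₁₄_half`: inertia exactly `(2+, 2−)` at `t = 1/2`. -/
theorem pos_two_T₁₄_half :
    let M : Matrix (Fin 4) (Fin 4) ℝ := ((1 / 2 : ℝ) ^ e₁₄) • J₁₄ + ∑ k, ((1 / 2 : ℝ) ^ d₁₄ k) • P₁₄ k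
    let p : Fin 4 → ℝ := ![1, 1, 1, 1]
    let q : Fin 4 → ℝ := ![1, 1, 0, 1]
    0 < p ⬝ᵥ (M *ᵥ p) ∧ 0 < q ⬝ᵥ (M *ᵥ q) ∧ 0 < (p ⬝ᵥ (M *ᵥ p)) * (q ⬝ᵥ (M *ᵥ q)) - (p ⬝ᵥ (M *ᵥ q)) ^ 2 := by
  simp only [P₁₄_eq, J₁₄, d₁₄, e₁₄, Fin.sum_univ_three]
  refine ⟨?_, ?_, ?_⟩ <;>
    simp [Matrix.mulVec, dotProduct, Fin.sum_univ_four, Matrix.add_apply] <;> norm_num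

/-- … while the determinant there is POSITIVE (the certificate's sign at `1/2` is `+`): an even number (two) of negative eigenvalues. -/
theorem det_pos_T₁₄_half : 0 < (T₁₄.det).eval (1 / 2) := by
  rw [eval_det_T₁₄]; norm_num

end Summit.ValiantsHypothesis.ValiantsHypothesis.Theorems.KPlusLogSqLaw.TowerGraft
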